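import Mathlib
import HarnessLib
import Literature.Dynamics.TopologicalDynamics.UniformRecurrence
import Literature.Analysis.FluidPDE.BarkerPrange2020VorticityAlignmentTypeIHolds
import Summits.NavierStokesRegularity.NavierStokesRegularity.Theorems.PoloidalWindowDoorPoloidalWindowRigidityHotHullSlabUniform

/-!
# Route `PoloidalWindowDoor`, crux `PoloidalWindowRigidity` (K2, stmt-NavierStokesRegularity-19708) — THICK / (TH) column infrastructure:
# BIRKHOFF RECURRENCE for a continuous `ℝ`-action on a compact hull of PAIRS (class profile, continuous tag) — generic wrapper

Cell ns-regularity-ideate, seat ns-poloidal-K2-p2 g15 (DIRECTOR-NS #301 (A)(1): the recurrent upgrade of the (Q4) object of item 20428).  This is the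
pair version of g14's `…HullBirkhoff.exists_recurrent_of_action` (p714549): there the phase point was a profile `U` and the second coordinate an OBSERVABLE
`obs U` (a function of `U`); here the second coordinate is a FREE continuous tag `g : ℝ³ → ℝ³` carried along by the action.  This is what the ridge needs: the
hot branch `Γ` of a (TH)-profile is not a function of the profile (orientation; global uniqueness is not available by name), so the slide
`Φ_σ (U, Γ) = (U(·, · + Γ σ), Γ(· + σ) − Γ σ)` is an action on PAIRS — and on pairs the flow law and the sequential continuity are immediate.

`exists_recurrent_of_pairAction`: let `Ω` be a non-empty set of pairs `(U, g)` with `U ∈ A_C` and `g` continuous, SEQUENTIALLY COMPACT AND CLOSED for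
(slice-wise locally uniform convergence of all slices `t < 0`) ∧ (locally uniform convergence of the tags), and `Φ : ℝ → pair → pair` an action preserving `Ω`
with `Φ (s + t) = Φ s ∘ Φ t` on `Ω`, SEQUENTIALLY CONTINUOUS on `Ω` for that convergence.  Then some `(U, g) ∈ Ω` is UNIFORMLY RECURRENT: for every `ε > 0` and
every slab index `n` the set of `σ` with `(Φ σ (U,g)).1` `ε`-close to `U` on `[−(n+2), −(n+2)⁻¹] × B̄_{n+2}` and `(Φ σ (U,g)).2` `ε`-close to `g` on `B̄_{n+2}` is
relatively dense in `ℝ`.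

PROOF: verbatim the proof of p714549 with the observable slot replaced by the tag: phase space `X := Ω` with the uniform structure pulled back along
`Ψ : (U, g) ↦ (n ↦ ((t,x) ↦ (U t x, g x))|_{slab n}) ∈ Π n, C(slab n, ℝ³ × ℝ³)` (countably generated ⇒ pseudo-metrisable ⇒ `IsSeqCompact.isCompact`,
`continuous_iff_seqContinuous`); convergence in `X` ⇔ the hull convergence by the class-uniform KNSS moduli `…HotHullSlabUniform.tendstoUniformlyOn_slab`; then the
tree's Birkhoff–Furstenberg `exists_isUniformlyRecurrentPt` and `isSyndetic_iff_exists_window`.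

WHAT THIS IS NOT: not a claim about Navier–Stokes regularity — topological-dynamics infrastructure for the supports of a door route (bears_on LADDER-NS N0,
rung N0-LocalTubeDoorPoloidal; item 20428 / crux 19708 OPEN; the research cell (Q4) OPEN; NS regularity NOT proved).
-/

noncomputable section

-- the summit and its single sub-problem share the name (CONVENTIONS §1), as in every Theorems file
set_option linter.dupNamespace false

namespace Summit.NavierStokesRegularity.NavierStokesRegularity.Theorems.PoloidalWindowDoorPoloidalWindowRigidityHullBirkhoffPair

open Set Function Filter Topology Metric
open scoped NNReal Uniformity Topology
open Literature.Analysis Literature.Analysis.FluidPDE Literature.Analysis.UnboundedOperators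
open Literature.Dynamics.TopologicalDynamics
open Summit.NavierStokesRegularity.NavierStokesRegularity.Theorems
open PoloidalWindowDoorPoloidalWindowRigidityHotHullSlabUniform

/-- **Birkhoff recurrence for a continuous `ℝ`-action on a compact hull of pairs (class profile, continuous tag).**  See the module docstring. -/
theorem exists_recurrent_of_pairAction (C : ℝ)
    (Ω : Set ((ℝ → EuclideanSpace ℝ (Fin 3) → EuclideanSpace ℝ (Fin 3)) × (EuclideanSpace ℝ (Fin 3) → EuclideanSpace ℝ (Fin 3)))) (hne : Ω.Nonempty)
    (hcls : ∀ p ∈ Ω, IsTypeIAncientMild C p.1)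
    (hobs : ∀ p ∈ Ω, Continuous p.2)
    (hcpt : ∀ ps : ℕ → (ℝ → EuclideanSpace ℝ (Fin 3) → EuclideanSpace ℝ (Fin 3)) × (EuclideanSpace ℝ (Fin 3) → EuclideanSpace ℝ (Fin 3)),
      (∀ k, ps k ∈ Ω) →
      ∃ (φ : ℕ → ℕ) (p : (ℝ → EuclideanSpace ℝ (Fin 3) → EuclideanSpace ℝ (Fin 3)) × (EuclideanSpace ℝ (Fin 3) → EuclideanSpace ℝ (Fin 3))),
        StrictMono φ ∧ p ∈ Ω ∧
        (∀ t < 0, TendstoLocallyUniformly (fun j => (ps (φ j)).1 t) (p.1 t) atTop) ∧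
        TendstoLocallyUniformly (fun j => (ps (φ j)).2) p.2 atTop)
    (Φ : ℝ → (ℝ → EuclideanSpace ℝ (Fin 3) → EuclideanSpace ℝ (Fin 3)) × (EuclideanSpace ℝ (Fin 3) → EuclideanSpace ℝ (Fin 3)) →
      (ℝ → EuclideanSpace ℝ (Fin 3) → EuclideanSpace ℝ (Fin 3)) × (EuclideanSpace ℝ (Fin 3) → EuclideanSpace ℝ (Fin 3)))
    (hinv : ∀ p ∈ Ω, ∀ σ : ℝ, Φ σ p ∈ Ω) (hadd : ∀ p ∈ Ω, ∀ s t : ℝ, Φ (s + t) p = Φ s (Φ t p))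
    (hcont : ∀ σ : ℝ,
      ∀ (ps : ℕ → (ℝ → EuclideanSpace ℝ (Fin 3) → EuclideanSpace ℝ (Fin 3)) × (EuclideanSpace ℝ (Fin 3) → EuclideanSpace ℝ (Fin 3)))
        (p : (ℝ → EuclideanSpace ℝ (Fin 3) → EuclideanSpace ℝ (Fin 3)) × (EuclideanSpace ℝ (Fin 3) → EuclideanSpace ℝ (Fin 3))),
      (∀ k, ps k ∈ Ω) → p ∈ Ω → (∀ t < 0, TendstoLocallyUniformly (fun k => (ps k).1 t) (p.1 t) atTop) →
      TendstoLocallyUniformly (fun k => (ps k).2) p.2 atTop →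
      (∀ t < 0, TendstoLocallyUniformly (fun k => (Φ σ (ps k)).1 t) ((Φ σ p).1 t) atTop) ∧
        TendstoLocallyUniformly (fun k => (Φ σ (ps k)).2) (Φ σ p).2 atTop) :
    ∃ p ∈ Ω, ∀ ε : ℝ, 0 < ε → ∀ n : ℕ, ∃ L : ℝ, 0 < L ∧ ∀ a : ℝ, ∃ σ ∈ Icc a (a + L),
      (∀ t ∈ Icc (-((n : ℝ) + 2)) (-((n : ℝ) + 2)⁻¹), ∀ x ∈ closedBall (0 : EuclideanSpace ℝ (Fin 3)) ((n : ℝ) + 2),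
        dist ((Φ σ p).1 t x) (p.1 t x) < ε) ∧
      (∀ x ∈ closedBall (0 : EuclideanSpace ℝ (Fin 3)) ((n : ℝ) + 2), dist ((Φ σ p).2 x) (p.2 x) < ε) := by
  classical
  have hslice : ∀ p ∈ Ω, ∀ t < 0, Continuous (p.1 t) := fun p hp t ht => ((hcls p hp).analyticOnNhd_slice_univ ht).continuous
  -- the phase space and the action
  let X := {p : (ℝ → EuclideanSpace ℝ (Fin 3) → EuclideanSpace ℝ (Fin 3)) × (EuclideanSpace ℝ (Fin 3) → EuclideanSpace ℝ (Fin 3)) // p ∈ Ω}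
  let ϕ : ℝ → X → X := fun σ p => ⟨Φ σ p.1, hinv p.1 p.2 σ⟩
  have haddX : ∀ s t (p : X), ϕ (s + t) p = ϕ s (ϕ t p) := fun s t p => Subtype.ext (hadd p.1 p.2 s t)
  -- the compact slabs and the embedding `Ψ`
  let Sn : ℕ → Set (ℝ × EuclideanSpace ℝ (Fin 3)) := fun n =>
    Icc (-((n : ℝ) + 2)) (-((n : ℝ) + 2)⁻¹) ×ˢ closedBall (0 : EuclideanSpace ℝ (Fin 3)) ((n : ℝ) + 2)
  have hSnc : ∀ n, IsCompact (Sn n) := fun n => isCompact_Icc.prod (isCompact_closedBall _ _)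
  haveI hSncs : ∀ n, CompactSpace (Sn n) := fun n => isCompact_iff_compactSpace.1 (hSnc n)
  have hn2 : ∀ n : ℕ, (1 : ℝ) ≤ (n : ℝ) + 2 := fun n => by have := n.cast_nonneg (α := ℝ); linarith
  have hSn_neg : ∀ n, ∀ p ∈ Sn n, p.1 < 0 := fun n p hp => by
    have h1 : p.1 ≤ -((n : ℝ) + 2)⁻¹ := (mem_prod.1 hp).1.2
    have h2 : (0 : ℝ) < ((n : ℝ) + 2)⁻¹ := by positivity
    linarith
  have hm1 : ∀ n : ℕ, (-1 : ℝ) ∈ Icc (-((n : ℝ) + 2)) (-((n : ℝ) + 2)⁻¹) := fun n =>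
    ⟨by linarith [hn2 n], by rw [neg_le_neg_iff]; exact inv_le_one_of_one_le₀ (hn2 n)⟩
  have hΨc : ∀ (p : X) (n : ℕ), Continuous fun q : Sn n => (p.1.1 q.1.1 q.1.2, p.1.2 q.1.2) := fun p n => by
    refine Continuous.prodMk ?_ ((hobs p.1 p.2).comp (continuous_snd.comp continuous_subtype_val))
    exact (hcls p.1 p.2).continuousOn_uncurry.comp_continuous continuous_subtype_val fun q => ⟨hSn_neg n q.1 q.2, mem_univ _⟩
  let Ψ : X → ((n : ℕ) → C(Sn n, EuclideanSpace ℝ (Fin 3) × EuclideanSpace ℝ (Fin 3))) := fun p n =>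
    ⟨fun q => (p.1.1 q.1.1 q.1.2, p.1.2 q.1.2), hΨc p n⟩
  -- the phase-space topology: pulled back along `Ψ`
  letI uX : UniformSpace X := UniformSpace.comap Ψ inferInstance
  letI tX : TopologicalSpace X := uX.toTopologicalSpace
  haveI hcg : IsCountablyGenerated (𝓤 X) := by
    show IsCountablyGenerated 𝓤[UniformSpace.comap Ψ inferInstance]
    rw [uniformity_comap]
    infer_instance
  haveI : TopologicalSpace.PseudoMetrizableSpace X := inferInstance
  haveI : Nonempty X := ⟨⟨hne.some, hne.some_mem⟩⟩
  have hΨind : Topology.IsInducing Ψ := ⟨rfl⟩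
  have hconvX : ∀ {ps : ℕ → X} {p : X}, Tendsto ps atTop (𝓝 p) ↔
      ∀ n, TendstoUniformly (fun k (q : Sn n) => Ψ (ps k) n q) (Ψ p n) atTop := by
    intro ps p
    rw [hΨind.tendsto_nhds_iff, tendsto_pi_nhds]
    exact forall_congr' fun n => ContinuousMap.tendsto_iff_tendstoUniformly
  have hX_to_hull : ∀ {ps : ℕ → X} {p : X}, Tendsto ps atTop (𝓝 p) →
      (∀ t < 0, TendstoLocallyUniformly (fun k => (ps k).1.1 t) (p.1.1 t) atTop) ∧
      TendstoLocallyUniformly (fun k => (ps k).1.2) p.1.2 atTop := by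
    intro ps p h
    rw [hconvX] at h
    constructor
    · intro t ht
      rw [tendstoLocallyUniformly_iff_forall_isCompact]
      intro Kc hKc
      obtain ⟨r, hr⟩ := hKc.isBounded.subset_closedBall 0
      obtain ⟨n, hn⟩ := exists_nat_ge (max (max r (-t)) (-t)⁻¹)
      have hnr : r ≤ (n : ℝ) + 2 := by linarith [le_max_left (max r (-t)) (-t)⁻¹, le_max_left r (-t)]
      have ht1 : -((n : ℝ) + 2) ≤ t := by linarith [le_max_left (max r (-t)) (-t)⁻¹, le_max_right r (-t)]
      have ht2 : t ≤ -((n : ℝ) + 2)⁻¹ := by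
        have h1 : (-t)⁻¹ ≤ (n : ℝ) + 2 := by linarith [le_max_right (max r (-t)) (-t)⁻¹]
        have h2 : ((n : ℝ) + 2)⁻¹ ≤ -t := inv_le_of_inv_le₀ (by linarith) h1
        linarith
      rw [Metric.tendstoUniformlyOn_iff]
      intro ε hε
      filter_upwards [Metric.tendstoUniformly_iff.1 (h n) ε hε] with k hk x hx
      have hp : (t, x) ∈ Sn n := mem_prod.2 ⟨⟨ht1, ht2⟩, closedBall_subset_closedBall hnr (hr hx)⟩
      have h1 := hk ⟨(t, x), hp⟩
      rw [Prod.dist_eq, max_lt_iff] at h1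
      exact h1.1
    · rw [tendstoLocallyUniformly_iff_forall_isCompact]
      intro Kc hKc
      obtain ⟨r, hr⟩ := hKc.isBounded.subset_closedBall 0
      obtain ⟨n, hn⟩ := exists_nat_ge r
      have hnr : r ≤ (n : ℝ) + 2 := by linarith
      rw [Metric.tendstoUniformlyOn_iff]
      intro ε hε
      filter_upwards [Metric.tendstoUniformly_iff.1 (h n) ε hε] with k hk x hx
      have hp : ((-1 : ℝ), x) ∈ Sn n := mem_prod.2 ⟨hm1 n, closedBall_subset_closedBall hnr (hr hx)⟩
      have h1 := hk ⟨((-1 : ℝ), x), hp⟩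
      rw [Prod.dist_eq, max_lt_iff] at h1
      exact h1.2
  have hhull_to_X : ∀ {ps : ℕ → X} {p : X}, (∀ t < 0, TendstoLocallyUniformly (fun k => (ps k).1.1 t) (p.1.1 t) atTop) →
      TendstoLocallyUniformly (fun k => (ps k).1.2) p.1.2 atTop → Tendsto ps atTop (𝓝 p) := by
    intro ps p hsl hcu
    rw [hconvX]
    intro n
    have hslab := tendstoUniformlyOn_slab C (u := fun k => (ps k).1.1) (U := p.1.1) (fun k => (hcls _ (ps k).2).hasTypeITimeDecay)
      (fun k => (hcls _ (ps k).2).continuousOn_uncurry) (fun k s t hst ht x => (hcls _ (ps k).2).mild_eq_heatExtension hst ht x)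
      (fun k t ht => (hcls _ (ps k).2).isDivFree ht) (hcls _ p.2).hasTypeITimeDecay (hcls _ p.2).continuousOn_uncurry
      (fun s t hst ht x => (hcls _ p.2).mild_eq_heatExtension hst ht x) (fun t ht => (hcls _ p.2).isDivFree ht)
      (fun t ht x => (hsl t ht).tendsto_comp ((hslice _ p.2 t ht).continuousAt) tendsto_const_nhds) (hn2 n)
    have htagU := (tendstoLocallyUniformly_iff_forall_isCompact.1 hcu) _ (isCompact_closedBall (0 : EuclideanSpace ℝ (Fin 3)) ((n : ℝ) + 2))
    rw [Metric.tendstoUniformly_iff]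
    intro ε hε
    filter_upwards [Metric.tendstoUniformlyOn_iff.1 hslab ε hε, Metric.tendstoUniformlyOn_iff.1 htagU ε hε] with k hk1 hk2 q
    rw [Prod.dist_eq, max_lt_iff]
    exact ⟨hk1 q.1 q.2, hk2 q.1.2 (mem_prod.1 q.2).2⟩
  -- compactness and continuity
  have hseq : IsSeqCompact (univ : Set X) := by
    intro ps _
    obtain ⟨φ, p, hφ, hpΩ, hsl, hcu⟩ := hcpt (fun k => (ps k).1) (fun k => (ps k).2)
    exact ⟨⟨p, hpΩ⟩, mem_univ _, φ, hφ, hhull_to_X (ps := ps ∘ φ) (p := ⟨p, hpΩ⟩) hsl hcu⟩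
  have hcompact : IsCompact (univ : Set X) := hseq.isCompact
  have hcontϕ : ∀ σ, Continuous (ϕ σ) := by
    intro σ
    refine continuous_iff_seqContinuous.2 fun ps p h => ?_
    obtain ⟨hsl, hcu⟩ := hX_to_hull h
    obtain ⟨h1, h2⟩ := hcont σ (fun k => (ps k).1) p.1 (fun k => (ps k).2) p.2 hsl hcu
    exact hhull_to_X (ps := fun k => ϕ σ (ps k)) (p := ϕ σ p) h1 h2
  -- Birkhoff–Furstenberg
  obtain ⟨pstar, -, hrec⟩ := exists_isUniformlyRecurrentPt (G := ℝ) (ϕ := ϕ) hcontϕ haddX hcompact univ_nonempty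
    (fun σ => mapsTo_univ _ _)
  refine ⟨pstar.1, pstar.2, fun ε hε n => ?_⟩
  set N : Set X := Ψ ⁻¹' {y | y n ∈ ball (Ψ pstar n) ε} with hN
  have hNo : IsOpen N := (isOpen_ball.preimage (continuous_apply n)).preimage hΨind.continuous
  have hNmem : pstar ∈ N := by
    show Ψ pstar n ∈ ball (Ψ pstar n) ε
    exact mem_ball_self hε
  obtain ⟨L, hL, hwin⟩ := isSyndetic_iff_exists_window.1 (hrec N (hNo.mem_nhds hNmem))
  refine ⟨L, hL, fun a => ?_⟩
  obtain ⟨σ, hσ, hσN⟩ := hwin a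
  have hd : dist (Ψ (ϕ σ pstar) n) (Ψ pstar n) < ε := by
    have : Ψ (ϕ σ pstar) n ∈ ball (Ψ pstar n) ε := hσN
    exact mem_ball.1 this
  have hpt : ∀ q : Sn n, dist ((Ψ (ϕ σ pstar) n) q) ((Ψ pstar n) q) < ε := fun q =>
    (ContinuousMap.dist_apply_le_dist q).trans_lt hd
  refine ⟨σ, hσ, fun t ht x hx => ?_, fun x hx => ?_⟩
  · have h := hpt ⟨(t, x), mem_prod.2 ⟨ht, hx⟩⟩
    rw [Prod.dist_eq, max_lt_iff] at h
    exact h.1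
  · have h := hpt ⟨((-1 : ℝ), x), mem_prod.2 ⟨hm1 n, hx⟩⟩
    rw [Prod.dist_eq, max_lt_iff] at h
    exact h.2

end Summit.NavierStokesRegularity.NavierStokesRegularity.Theorems.PoloidalWindowDoorPoloidalWindowRigidityHullBirkhoffPair

end
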